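import Summits.BirchSwinnertonDyer.BirchSwinnertonDyer.Theorems.ByReductionTypeAtTwoAdditivePotGoodPrintKrizLi92b1Base
import Literature.NumberTheory.EllipticCurves.OrdinaryPrimesProofs
import Literature.NumberTheory.EllipticCurves.LeadingTermTamagawaProofs
import Mathlib.Tactic.NormNum.LegendreSymbol
import HarnessLib

/-!
# Route `GenusKolyvaginAtTwo`, crux U₂ `MinimalTwinBSDTwo` (stmt-BirchSwinnertonDyer-22985), LINE 23 «twin_swap»: KERNEL data of the Kriz–Li
# RANK-ONE ANCHOR `43a1 = [0,1,1,0,0]` (`y² + y = x³ + x²`; Cremona Table 1 «43 A1»: `N = 43`, `r = 1`, `#T = 1`, `Δ = −43`, Kodaira `I₁` at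
# `43`, GOOD at `2`; Kriz–Li Table 1 row `43a1 | −7 | 1 | ✓`) over `K = ℚ(√−7)` — ellipticity, global minimality, `E[2]` irreducible (the
# `2`-division cubic `X³ + 4X² + 16` has no root mod `11`), good (supersingular) reduction at `2` with `c₂ = 1`, non-CM, `N = 43` EXACTLY, a
# rational point of INFINITE ORDER (`6·(0,0) = (−2/9, −28/27)`); the partner `43a1^{(−7)} = [0,−7,1,0,−86]` (`I₀*` at `7`, `I₁` at `43`:
# `N = 7²·43 = 2107 < 5000`); the packet witness `ℓ = 11` (`#Ẽ(𝔽₁₁) = 9`, `a₁₁ = 3` odd)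

Seat `bsd-line-gk2-p2` g34 (PROVER 2/3, cell `bsd-f1-sign2`; LINE 23 holder), `--supports stmt-BirchSwinnertonDyer-22985` (helper; closes nothing).
KERNEL THEOREMS ONLY (0 `def`, 0 `sorry`, no named fact); standard axioms.  Companion of `…KrizLiAnchor37a1Base.lean` (this seat) and of the K4
seat's `…PrintKrizLi92b1Base.lean` (cell `bsd-2adic`): `43a1` is the second row of Kriz–Li's Table 1 and, with `37a1` and `92b1`, one of the
three rank-one rows with `c₂(E)` odd and `d_K²·N < 5000` — BOTH numerical `BSD(2)` inputs of Kriz–Li Thm 5.1 (2) (the base and its companion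
`43a1^{(−7)}`, `N = 2107`) lie in Creutz–Miller's range, so `BSD₂` on the whole Kriz–Li packet `{43a1^{(d)}, 43a1^{(−7d)} : d ∈ 𝒩, χ_d(−43) = 1}`
follows from PRINT ALONE (road file `…KrizLiAnchor43a1.lean`).  `Δ(43a1) = −43 < 0`: the frame `ℚ(√−7)` carries exactly ONE transposition prime
(`(Δ/7) = −1`, `a₇ = 0`), i.e. it is a budget-`1` frame of LINE 23's NVFROB on the `Δ < 0` cell — the anchor sits on the `Δ < 0` side where
`37a1` (`Δ = 37`, budget `0`) sits on the `Δ > 0` side.  Tate certificate at `7` for the partner: the b2b engine `DeepCert` (exit `6` = `I₀*`,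
translation `t = 24`).  Closes nothing; nothing booked; **BSD is NOT proved by any of this; U₂ is NOT proved.**

References: [KrizLi2019] Thm 5.1 (2), Def 4.1, §6 Table 1 (row 43a1); [CremonaAlgorithms1997] Table 1 (43A1; 2107); [SilvermanAEC2009] III.2.3,
VII.1, VII.3.4, VII.5, X.5, App. C §11; [Silverman1994] IV.9.4, IV.11.1; [Kraus1989] Prop. 1–2.
-/

set_option autoImplicit false
-- the Theorems namespace of this sub repeats the summit name by design (D-0017 nested layout)
set_option linter.dupNamespace false

noncomputable section

open scoped Classical NumberField

open WeierstrassCurve IsDedekindDomain Rat.HeightOneSpectrum Literature.NumberTheory.EllipticCurves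
  Literature.NumberTheory.EllipticCurves.ModularForms
  Literature.NumberTheory.EllipticCurves.Rank1Residual
  Literature.NumberTheory.DiophantineGeometry
  Summit.BirchSwinnertonDyer
  Summit.BirchSwinnertonDyer.Rank1Residual
  Summit.BirchSwinnertonDyer.Rank1Residual.X11b
  Summit.BirchSwinnertonDyer.Rank1Residual.X5.O1
  Summit.BirchSwinnertonDyer.Rank1Residual.P2
  Summit.BirchSwinnertonDyer.BirchSwinnertonDyer.Rank1Residual.IntModel
  Summit.BirchSwinnertonDyer.BirchSwinnertonDyer.Theorems
  Summit.BirchSwinnertonDyer.BirchSwinnertonDyer.Theorems.AddPotGoodPrint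
  Summit.BirchSwinnertonDyer.BirchSwinnertonDyer.Rank2Observatory.Tate

namespace Summit.BirchSwinnertonDyer.BirchSwinnertonDyer.Theorems.GenusExact.TwinSwap.KrizLiAnchor43a1

/-! ## §1 The anchor `43a1 = [0, 1, 1, 0, 0]`: `Δ = −43`, `c₄ = 16`, GOOD at `2`, `I₁` at `43` -/
section Base43A1

/-- `43a1 = [0, 1, 1, 0, 0]` is an elliptic curve (`Δ = −43 ≠ 0`). [cite: CremonaAlgorithms1997, Table 1 (43A1)] -/
theorem isElliptic_43A1 : (⟨0, 1, 1, 0, 0⟩ : WeierstrassCurve ℚ).IsElliptic := ⟨by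
  rw [isUnit_iff_ne_zero]; norm_num [WeierstrassCurve.Δ, WeierstrassCurve.b₂, WeierstrassCurve.b₄, WeierstrassCurve.b₆, WeierstrassCurve.b₈]⟩

/-- `43a1` is GLOBALLY MINIMAL (`|Δ| = 43`). [cite: SilvermanAEC2009, VII.1 Remark 1.1] [cite: Kraus1989, Prop. 1 and Prop. 2] -/
theorem isGloballyMinimal_43A1 : (⟨0, 1, 1, 0, 0⟩ : WeierstrassCurve ℚ).IsGloballyMinimal :=
  isGloballyMinimal_of_krausCriterion_support (0) (1) (1) (0) (0) [(43, 0, 1)]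
    (by intro t ht; simp only [List.mem_cons, List.not_mem_nil, or_false] at ht
        rcases ht with rfl; norm_num)
    (by decide +kernel) (by decide +kernel)

/-- `Δ(43a1) = −43` on the integer model. [cite: CremonaAlgorithms1997, Table 1 (43A1)] -/
theorem M43A1_Δ : (⟨0, 1, 1, 0, 0⟩ : WeierstrassCurve ℤ).Δ = -43 := by decide +kernel
/-- `c₄(43a1) = 16` on the integer model. [cite: CremonaAlgorithms1997, Table 1 (43A1)] -/
theorem M43A1_c₄ : (⟨0, 1, 1, 0, 0⟩ : WeierstrassCurve ℤ).c₄ = 16 := by decide +kernel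
/-- `Δ(43a1) < 0` (rational model). [cite: CremonaAlgorithms1997, Table 1 (43A1)] -/
theorem Δ_sign_43A1 : (⟨0, 1, 1, 0, 0⟩ : WeierstrassCurve ℚ).Δ < 0 := by
  norm_num [WeierstrassCurve.Δ, WeierstrassCurve.b₂, WeierstrassCurve.b₄, WeierstrassCurve.b₆, WeierstrassCurve.b₈]

/-- The integer model of `43a1` is Cremona's. [cite: SilvermanAEC2009, VIII.8] -/
theorem intModel_43A1 :
    haveI := isElliptic_43A1; haveI := isGloballyMinimal_43A1
    integralModelInt (⟨0, 1, 1, 0, 0⟩ : WeierstrassCurve ℚ) = (⟨0, 1, 1, 0, 0⟩ : WeierstrassCurve ℤ) :=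
  haveI := isElliptic_43A1; haveI := isGloballyMinimal_43A1
  integralModelInt_eq_of_map_eq _ (by ext <;> simp [WeierstrassCurve.map])

/-- The integer model base-changed to `ℚ` is the rational model. [folklore] -/
theorem baseChange_int_43A1 : (⟨0, 1, 1, 0, 0⟩ : WeierstrassCurve ℤ).baseChange ℚ = (⟨0, 1, 1, 0, 0⟩ : WeierstrassCurve ℚ) := by
  ext <;> simp [WeierstrassCurve.baseChange, WeierstrassCurve.map]

/-- `b₂, b₄, b₆` of `43a1`. [cite: SilvermanAEC2009, III.1] -/
theorem b_43A1 : (⟨0, 1, 1, 0, 0⟩ : WeierstrassCurve ℚ).b₂ = ((4 : ℤ) : ℚ) ∧ (⟨0, 1, 1, 0, 0⟩ : WeierstrassCurve ℚ).b₄ = ((0 : ℤ) : ℚ) ∧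
    (⟨0, 1, 1, 0, 0⟩ : WeierstrassCurve ℚ).b₆ = ((1 : ℤ) : ℚ) := by
  simp only [WeierstrassCurve.b₂, WeierstrassCurve.b₄, WeierstrassCurve.b₆]; norm_num

/-- **`E[2]` irreducible for `43a1`** (`E(ℚ)[2] = 0`; Cremona `#T = 1`): the monic `2`-division cubic `X³ + 4X² + 16` has no root modulo `11`.
[cite: SilvermanAEC2009, III.2.3 (b)] [cite: KrizLi2019, Thm. 5.1 (hypothesis E(ℚ)[2] = 0)] -/
theorem irr_two_43A1 :
    haveI := isElliptic_43A1
    Irr (⟨0, 1, 1, 0, 0⟩ : WeierstrassCurve ℚ) 2 :=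
  haveI := isElliptic_43A1
  irr_two_of_forall_cubic_ne _ b_43A1.1 b_43A1.2.1 b_43A1.2.2 (ℓ := 11) (by decide)

/-- **`E(ℚ)[2] = 0` for `43a1`** in Kriz–Li's shape. [cite: KrizLi2019, Thm. 5.1 hypothesis "E(ℚ)[2] = 0"] -/
theorem twoTorsion_43A1 :
    haveI := isElliptic_43A1
    ∀ Q : (⟨0, 1, 1, 0, 0⟩ : WeierstrassCurve ℚ).toAffine.Point, 2 • Q = 0 → Q = 0 :=
  haveI := isElliptic_43A1
  (X5.O1.irr_two_iff_forall_two_nsmul _).mp irr_two_43A1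

/-- **`43a1` has GOOD reduction at `2`** (`2 ∤ Δ_min = −43`). [cite: SilvermanAEC2009, VII.5 Prop. 5.1 (a)] [cite: KrizLi2019, §6 Table 1 (row 43a1: c₂ = 1)] -/
theorem hasGoodReductionAtPrime_two_43A1 :
    haveI := isGloballyMinimal_43A1; haveI : Fact (Nat.Prime 2) := ⟨Nat.prime_two⟩
    (⟨0, 1, 1, 0, 0⟩ : WeierstrassCurve ℚ).HasGoodReductionAtPrime 2 := by
  haveI := isElliptic_43A1; haveI := isGloballyMinimal_43A1
  haveI : Fact (Nat.Prime 2) := ⟨Nat.prime_two⟩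
  refine hasGoodReductionAtPrime_of_not_dvd _ 2 ?_
  rw [minimalDiscriminantInt_eq intModel_43A1, M43A1_Δ]; decide

/-- **`c₂(43a1) = 1`** (good reduction: Tate's Step 1). [cite: SilvermanAEC2009, VII.2 remark after Prop. 2.1] [cite: KrizLi2019, §6 Table 1 (row 43a1: c₂ = 1)] -/
theorem localTamagawaNumber_two_43A1 :
    haveI : Fact (Nat.Prime 2) := ⟨Nat.prime_two⟩
    ((⟨0, 1, 1, 0, 0⟩ : WeierstrassCurve ℚ).baseChange ℚ_[2]).localTamagawaNumber ℤ_[2] = 1 :=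
  haveI := isGloballyMinimal_43A1
  haveI : Fact (Nat.Prime 2) := ⟨Nat.prime_two⟩
  localTamagawaNumber_padic_eq_one_of_good_holds _ 2 hasGoodReductionAtPrime_two_43A1

/-- **`c₂(43a1)` is ODD** (`= 1`). [cite: KrizLi2019, Thm. 5.1 (hypothesis "c₂(E) odd") and §6 Table 1 (row 43a1)] -/
theorem odd_localTamagawaNumber_two_43A1 :
    haveI : Fact (Nat.Prime 2) := ⟨Nat.prime_two⟩
    Odd (((⟨0, 1, 1, 0, 0⟩ : WeierstrassCurve ℚ).baseChange ℚ_[2]).localTamagawaNumber ℤ_[2]) := by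
  rw [localTamagawaNumber_two_43A1]; exact odd_one

/-- **`43a1` is non-CM**: multiplicative at `43` (`43 ∣ Δ`, `43 ∤ c₄ = 16`), so `ord₄₃ j < 0`. [cite: SilvermanAEC2009, App. C §11] -/
theorem not_hasCM_43A1 :
    haveI := isElliptic_43A1
    ¬ (⟨0, 1, 1, 0, 0⟩ : WeierstrassCurve ℚ).HasCM := by
  haveI := isElliptic_43A1; haveI := isGloballyMinimal_43A1
  haveI : Fact (Nat.Prime 43) := ⟨by norm_num⟩
  exact AdditivePotMult.not_hasCM_of_padicValRat_j_neg (p := 43) (EisensteinPrimes.padicValRat_j_neg_of_mult _ 43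
    (hasMultiplicativeReductionAtPrime_of_intModel intModel_43A1 43 (by rw [M43A1_Δ]; decide) (by rw [M43A1_c₄]; decide)))

/-- **`1 ≤ rank_ℤ 43a1(ℚ)` IN THE KERNEL**: the rational point `6·(0,0) = (−2/9, −28/27)` has `3 ∣ 9`, so it has infinite order (kind `NL`,
Silverman VII.3.4, tree `one_le_mordellWeilRank_of_dvd_den`). [cite: SilvermanAEC2009, VII.3.4 and Thm. VIII.6.7] [cite: CremonaAlgorithms1997, Table 1 (43A1: r = 1, generator (0,0))] -/
theorem one_le_mordellWeilRank_43A1 :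
    haveI := isElliptic_43A1; haveI := isGloballyMinimal_43A1
    1 ≤ (⟨0, 1, 1, 0, 0⟩ : WeierstrassCurve ℚ).mordellWeilRank :=
  haveI := isElliptic_43A1; haveI := isGloballyMinimal_43A1
  one_le_mordellWeilRank_of_dvd_den (⟨0, 1, 1, 0, 0⟩ : WeierstrassCurve ℚ) 3 (by norm_num) (x := -2 / 9) (y := -28 / 27)
    (WeierstrassCurve.Affine.equation_iff_nonsingular.mp (by rw [WeierstrassCurve.Affine.equation_iff]; norm_num))
    (by norm_num)

/-- **`N(43a1) ∣ |Δ_min| = 43`.** [cite: SilvermanAEC2009, VIII.11 and C.16] -/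
theorem conductorNorm_dvd_43A1 :
    haveI := isElliptic_43A1
    (⟨0, 1, 1, 0, 0⟩ : WeierstrassCurve ℚ).conductorNorm ℤ ∣ 43 := by
  haveI := isElliptic_43A1; haveI := isGloballyMinimal_43A1
  have hdvd := WeierstrassCurve.conductorNorm_dvd_minimalDiscriminantNorm (⟨0, 1, 1, 0, 0⟩ : WeierstrassCurve ℚ)
    (WeierstrassCurve.finite_setOf_ordMinimalDiscriminant_ne_zero_holds _)
  rw [WeierstrassCurve.minimalDiscriminantNorm_int_eq_natAbs_minimalDiscriminantInt_holds,
    minimalDiscriminantInt_eq intModel_43A1, M43A1_Δ] at hdvd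
  exact hdvd

/-- **`ord₄₃ N(43a1) = 1`** (multiplicative at `43`). [cite: Silverman1994, IV.11.1] -/
theorem factorization_conductorNorm_43A1 :
    haveI := isElliptic_43A1
    ((⟨0, 1, 1, 0, 0⟩ : WeierstrassCurve ℚ).conductorNorm ℤ).factorization 43 = 1 := by
  haveI := isElliptic_43A1; haveI := isGloballyMinimal_43A1
  haveI hE : ((⟨0, 1, 1, 0, 0⟩ : WeierstrassCurve ℤ).baseChange ℚ).IsElliptic := by rw [baseChange_int_43A1]; infer_instance
  have h43 : Nat.Prime 43 := by norm_num
  set v : HeightOneSpectrum ℤ := (primesEquiv (R := ℤ)).symm ⟨43, h43⟩ with hv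
  have hgen : natGenerator v = 43 := congrArg Subtype.val ((primesEquiv (R := ℤ)).apply_symm_apply ⟨43, h43⟩)
  have hmin : ((⟨0, 1, 1, 0, 0⟩ : WeierstrassCurve ℤ).baseChange ℚ).IsMinimalAt v := by
    rw [baseChange_int_43A1]; exact IsGloballyMinimal.isMinimalAt_int _ v
  have h1 : ((⟨0, 1, 1, 0, 0⟩ : WeierstrassCurve ℤ).baseChange ℚ).conductorExponent v = 1 :=
    conductorExponent_eq_one_of_dvd_Δ_of_not_dvd_c₄ hmin (by rw [hgen, M43A1_Δ]; decide) (by rw [hgen, M43A1_c₄]; decide)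
  rw [baseChange_int_43A1] at h1
  rw [show (43 : ℕ) = ((⟨43, h43⟩ : Nat.Primes) : ℕ) from rfl, factorization_conductorNorm_primesEquiv_symm]
  exact h1

/-- **`N(43a1) = 43` IN THE KERNEL** (`N ∣ 43` and `43 ∣ N`). [cite: CremonaAlgorithms1997, Table 1 (43A1)] -/
theorem conductorNorm_43A1 :
    haveI := isElliptic_43A1
    (⟨0, 1, 1, 0, 0⟩ : WeierstrassCurve ℚ).conductorNorm ℤ = 43 := by
  haveI := isElliptic_43A1
  refine Nat.dvd_antisymm conductorNorm_dvd_43A1 ?_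
  have h := factorization_conductorNorm_43A1
  exact (Nat.Prime.dvd_iff_one_le_factorization (by norm_num) (conductorNorm_pos_holds _).ne').mpr (by omega)

/-- `N(43a1) ≠ 0` as an instance witness. [cite: CremonaAlgorithms1997, Table 1 (43A1)] -/
theorem neZero_conductorNorm_43A1 :
    haveI := isElliptic_43A1
    NeZero ((⟨0, 1, 1, 0, 0⟩ : WeierstrassCurve ℚ).conductorNorm ℤ) :=
  ⟨by rw [conductorNorm_43A1]; norm_num⟩

/-- **`N(43a1) < 5000`** (Creutz–Miller's range). [cite: CreutzMiller2012, Thm. 1.1] -/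
theorem conductorNorm_lt_5000_43A1 :
    haveI := isElliptic_43A1
    (⟨0, 1, 1, 0, 0⟩ : WeierstrassCurve ℚ).conductorNorm ℤ < 5000 := by
  rw [conductorNorm_43A1]; norm_num

end Base43A1

/-! ## §2 The partner `T′ = 43a1^{(−7)} = [0,−7,1,0,−86]`: global minimal, `Δ = −7⁶·43`, `N(T′) = 7²·43 = 2107 < 5000` -/
section Partner43A1

/-- **The tree's quadratic twist `43a1^{(−7)}` IS `[0,−7,0,0,−343/4]`** (`(b₂, b₄, b₆) = (4, 0, 1)`). [cite: SilvermanAEC2009, X.5 Cor. 5.4] -/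
theorem quadraticTwist_neg7_43A1 :
    (⟨0, 1, 1, 0, 0⟩ : WeierstrassCurve ℚ).quadraticTwist (-7) = (⟨0, -7, 0, 0, -343 / 4⟩ : WeierstrassCurve ℚ) := by
  ext <;> norm_num [WeierstrassCurve.quadraticTwist, WeierstrassCurve.b₂, WeierstrassCurve.b₄, WeierstrassCurve.b₆]

/-- **`(1, 0, 0, ½) • 43a1^{(−7)} = [0,−7,1,0,−86]`** — Cremona's minimal model of the companion. [cite: SilvermanAEC2009, III.1 Table 3.1 and X.5 Cor. 5.4] -/
theorem smul_quadraticTwist_neg7_43A1 :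
    (⟨1, 0, 0, (1 : ℚ) / 2⟩ : VariableChange ℚ) • (⟨0, 1, 1, 0, 0⟩ : WeierstrassCurve ℚ).quadraticTwist (-7) =
      (⟨0, -7, 1, 0, -86⟩ : WeierstrassCurve ℚ) := by
  rw [quadraticTwist_neg7_43A1]
  ext <;> norm_num [variableChange_a₁, variableChange_a₂, variableChange_a₃, variableChange_a₄, variableChange_a₆]

/-- `T′ = [0,−7,1,0,−86]` is an elliptic curve (`Δ = −7⁶·43 ≠ 0`). [cite: SilvermanAEC2009, III.1] -/
theorem isElliptic_T43A1 : (⟨0, -7, 1, 0, -86⟩ : WeierstrassCurve ℚ).IsElliptic := ⟨by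
  rw [isUnit_iff_ne_zero]; norm_num [WeierstrassCurve.Δ, WeierstrassCurve.b₂, WeierstrassCurve.b₄, WeierstrassCurve.b₆, WeierstrassCurve.b₈]⟩

/-- `T′` is GLOBALLY MINIMAL (`|Δ| = 7⁶·43`). [cite: SilvermanAEC2009, VII.1 Remark 1.1] [cite: Kraus1989, Prop. 1 and Prop. 2] -/
theorem isGloballyMinimal_T43A1 : (⟨0, -7, 1, 0, -86⟩ : WeierstrassCurve ℚ).IsGloballyMinimal :=
  isGloballyMinimal_of_krausCriterion_support (0) (-7) (1) (0) (-86) [(7, 0, 6), (43, 0, 1)]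
    (by intro t ht; simp only [List.mem_cons, List.not_mem_nil, or_false] at ht
        rcases ht with rfl | rfl <;> norm_num)
    (by decide +kernel) (by decide +kernel)

/-- `Δ(T′) = −5058907 = −7⁶·43`. [cite: CremonaAlgorithms1997, Table 1 (conductor 2107)] -/
theorem MT43A1_Δ : (⟨0, -7, 1, 0, -86⟩ : WeierstrassCurve ℤ).Δ = -5058907 := by decide +kernel
/-- `c₄(T′) = 784 = 2⁴·7²`. [cite: CremonaAlgorithms1997, Table 1 (conductor 2107)] -/
theorem MT43A1_c₄ : (⟨0, -7, 1, 0, -86⟩ : WeierstrassCurve ℤ).c₄ = 784 := by decide +kernel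

/-- The integer model base-changed to `ℚ` is the rational model. [folklore] -/
theorem baseChange_int_T43A1 :
    (⟨0, -7, 1, 0, -86⟩ : WeierstrassCurve ℤ).baseChange ℚ = (⟨0, -7, 1, 0, -86⟩ : WeierstrassCurve ℚ) := by
  ext <;> simp [WeierstrassCurve.baseChange, WeierstrassCurve.map]

/-- The integer model of `T′`. [cite: SilvermanAEC2009, VIII.8] -/
theorem intModel_T43A1 :
    haveI := isElliptic_T43A1; haveI := isGloballyMinimal_T43A1
    integralModelInt (⟨0, -7, 1, 0, -86⟩ : WeierstrassCurve ℚ) = (⟨0, -7, 1, 0, -86⟩ : WeierstrassCurve ℤ) :=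
  haveI := isElliptic_T43A1; haveI := isGloballyMinimal_T43A1
  integralModelInt_eq_of_map_eq _ (by ext <;> simp [WeierstrassCurve.map])

/-- **`N(T′) ∣ |Δ_min| = 5058907`.** [cite: SilvermanAEC2009, VIII.11 and C.16] -/
theorem conductorNorm_dvd_T43A1 :
    haveI := isElliptic_T43A1
    (⟨0, -7, 1, 0, -86⟩ : WeierstrassCurve ℚ).conductorNorm ℤ ∣ 5058907 := by
  haveI := isElliptic_T43A1; haveI := isGloballyMinimal_T43A1
  have hdvd := WeierstrassCurve.conductorNorm_dvd_minimalDiscriminantNorm (⟨0, -7, 1, 0, -86⟩ : WeierstrassCurve ℚ)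
    (WeierstrassCurve.finite_setOf_ordMinimalDiscriminant_ne_zero_holds _)
  rw [WeierstrassCurve.minimalDiscriminantNorm_int_eq_natAbs_minimalDiscriminantInt_holds,
    minimalDiscriminantInt_eq intModel_T43A1, MT43A1_Δ] at hdvd
  exact hdvd

/-- **Tate certificate for `T′` at `7`, kernel check** (Steps 1–6): translate by `(r,s,t) = (0,0,24)` to `[0,−7,49,0,−686]` (`7 ∣ a₂`, `7² ∣ a₃, a₄`,
`7³ ∣ a₆`); Step 6 exit: the cubic `T³ − T² − 2` has distinct roots mod `7` (discriminant `−116 ≢ 0`) — type `I₀*`, `v₇(Δ) = 6`.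
[cite: Silverman1994, IV.9.4 Steps 1–6] -/
theorem tateDeepCheck_seven_T43A1 : DeepCert.check ⟨7, 0, 0, 24, 6, 6, 0⟩ ⟨0, -7, 1, 0, -86⟩ = true := by
  decide +kernel

/-- **`f₇(T′) = 2`** (Ogg: `6 + 1 − 5` components of `I₀*`). [cite: Silverman1994, IV.11.1] -/
theorem conductorExponent_seven_T43A1 (v : HeightOneSpectrum ℤ) (hv : natGenerator v = 7) :
    (⟨0, -7, 1, 0, -86⟩ : WeierstrassCurve ℚ).conductorExponent v = 2 := by
  have h := DeepCert.conductorExponent_int_eq (W₀ := ⟨0, -7, 1, 0, -86⟩) (c := ⟨7, 0, 0, 24, 6, 6, 0⟩) v hv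
    (by rw [baseChange_int_T43A1]; exact isGloballyMinimal_T43A1) tateDeepCheck_seven_T43A1
  rw [baseChange_int_T43A1] at h
  exact h

/-- **`ord₇ N(T′) = 2`, `ord₄₃ N(T′) = 1`** (the latter: multiplicative at `43`, `43 ∣ Δ`, `43 ∤ c₄`). [cite: Silverman1994, IV.11.1] -/
theorem factorization_conductorNorm_T43A1 :
    haveI := isElliptic_T43A1
    (((⟨0, -7, 1, 0, -86⟩ : WeierstrassCurve ℚ).conductorNorm ℤ).factorization 7 = 2) ∧
      (((⟨0, -7, 1, 0, -86⟩ : WeierstrassCurve ℚ).conductorNorm ℤ).factorization 43 = 1) := by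
  haveI := isElliptic_T43A1; haveI := isGloballyMinimal_T43A1
  haveI hE : ((⟨0, -7, 1, 0, -86⟩ : WeierstrassCurve ℤ).baseChange ℚ).IsElliptic := by rw [baseChange_int_T43A1]; infer_instance
  have h7 : Nat.Prime 7 := by norm_num
  have h43 : Nat.Prime 43 := by norm_num
  refine ⟨?_, ?_⟩
  · rw [show (7 : ℕ) = ((⟨7, h7⟩ : Nat.Primes) : ℕ) from rfl, factorization_conductorNorm_primesEquiv_symm]
    exact conductorExponent_seven_T43A1 _ (congrArg Subtype.val ((primesEquiv (R := ℤ)).apply_symm_apply ⟨7, h7⟩))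
  · set v : HeightOneSpectrum ℤ := (primesEquiv (R := ℤ)).symm ⟨43, h43⟩ with hv
    have hgen : natGenerator v = 43 := congrArg Subtype.val ((primesEquiv (R := ℤ)).apply_symm_apply ⟨43, h43⟩)
    have hmin : ((⟨0, -7, 1, 0, -86⟩ : WeierstrassCurve ℤ).baseChange ℚ).IsMinimalAt v := by
      rw [baseChange_int_T43A1]; exact IsGloballyMinimal.isMinimalAt_int _ v
    have h1 : ((⟨0, -7, 1, 0, -86⟩ : WeierstrassCurve ℤ).baseChange ℚ).conductorExponent v = 1 :=
      conductorExponent_eq_one_of_dvd_Δ_of_not_dvd_c₄ hmin (by rw [hgen, MT43A1_Δ]; decide) (by rw [hgen, MT43A1_c₄]; decide)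
    rw [baseChange_int_T43A1] at h1
    rw [show (43 : ℕ) = ((⟨43, h43⟩ : Nat.Primes) : ℕ) from rfl, factorization_conductorNorm_primesEquiv_symm]
    exact h1

/-- The prime factorisation of `7ᵃ·43ᵇ`, read coefficientwise. [folklore] -/
theorem factorization_seven_pow_mul_fortythree_pow (a b q : ℕ) :
    (7 ^ a * 43 ^ b).factorization q = if q = 7 then a else if q = 43 then b else 0 := by
  have h7 : Nat.Prime 7 := by norm_num
  have h43 : Nat.Prime 43 := by norm_num
  rw [Nat.factorization_mul (pow_ne_zero _ h7.ne_zero) (pow_ne_zero _ h43.ne_zero), Finsupp.add_apply,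
    Nat.factorization_pow, Nat.factorization_pow, Finsupp.smul_apply, Finsupp.smul_apply, h7.factorization, h43.factorization,
    Finsupp.single_apply, Finsupp.single_apply]
  by_cases hq7 : q = 7
  · subst hq7; simp
  by_cases hq43 : q = 43
  · subst hq43; simp
  · simp [Ne.symm hq7, Ne.symm hq43, hq7, hq43]

/-- **`N(T′) = 2107 = 7²·43` IN THE KERNEL** (`N ∣ 7⁶·43`, `ord₇ N = 2`, `ord₄₃ N = 1`). [cite: CremonaAlgorithms1997, Table 1 (conductor 2107)] -/
theorem conductorNorm_T43A1 :
    haveI := isElliptic_T43A1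
    (⟨0, -7, 1, 0, -86⟩ : WeierstrassCurve ℚ).conductorNorm ℤ = 2107 := by
  haveI := isElliptic_T43A1
  set N := (⟨0, -7, 1, 0, -86⟩ : WeierstrassCurve ℚ).conductorNorm ℤ with hN
  have hN0 : N ≠ 0 := (conductorNorm_pos_holds _).ne'
  obtain ⟨h7, h43⟩ := factorization_conductorNorm_T43A1
  have hle := (Nat.factorization_le_iff_dvd hN0 (by norm_num : (5058907 : ℕ) ≠ 0)).mpr conductorNorm_dvd_T43A1
  have e2107 : (2107 : ℕ) = 7 ^ 2 * 43 ^ 1 := by norm_num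
  have eΔ : (5058907 : ℕ) = 7 ^ 6 * 43 ^ 1 := by norm_num
  refine Nat.eq_of_factorization_eq hN0 (by norm_num) fun q => ?_
  rw [e2107, factorization_seven_pow_mul_fortythree_pow]
  by_cases hq7 : q = 7
  · subst hq7; rw [h7]; simp
  by_cases hq43 : q = 43
  · subst hq43; rw [h43]; simp
  have hq' := hle q
  rw [eΔ, factorization_seven_pow_mul_fortythree_pow, if_neg hq7, if_neg hq43] at hq'
  rw [if_neg hq7, if_neg hq43]
  exact Nat.le_zero.mp hq'

/-- **`N(T′) < 5000`** (Creutz–Miller's range). [cite: CreutzMiller2012, Thm. 1.1] -/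
theorem conductorNorm_lt_5000_T43A1 :
    haveI := isElliptic_T43A1
    (⟨0, -7, 1, 0, -86⟩ : WeierstrassCurve ℚ).conductorNorm ℤ < 5000 := by
  rw [conductorNorm_T43A1]; norm_num

end Partner43A1

/-! ## §3 The packet witness `ℓ = 11`: `#Ẽ(𝔽₁₁) = 9` (`a₁₁ = 3` odd) -/
section Witness43A1

/-- **`#Ẽ(𝔽₁₁) = 9` for `43a1`** (certified count; `11 ∤ Δ = −43`), so `a₁₁ = 12 − 9 = 3`. [cite: SilvermanAEC2009, V.2] -/
theorem reductionPointCount_11_43A1 :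
    haveI := isGloballyMinimal_43A1
    (⟨0, 1, 1, 0, 0⟩ : WeierstrassCurve ℚ).reductionPointCount 11 = 9 := by
  haveI : Fact (Nat.Prime 11) := ⟨by norm_num⟩
  haveI := isElliptic_43A1; haveI := isGloballyMinimal_43A1
  exact Supersingular.reductionPointCount_eq_of_intModel_countPoints intModel_43A1 11 (by norm_num) (by decide +kernel)
    (by decide +kernel)

/-- **`a₁₁(43a1)` is odd** (`= 3`: `Frob₁₁` has order `3` on `E[2]`). [cite: KrizLi2019, Def. 4.1 ("Frob_ℓ of order 3")] -/
theorem odd_frobeniusTrace_11_43A1 :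
    haveI := isGloballyMinimal_43A1
    Odd ((⟨0, 1, 1, 0, 0⟩ : WeierstrassCurve ℚ).frobeniusTrace 11) := by
  haveI := isGloballyMinimal_43A1
  rw [Uniform.U2.odd_frobeniusTrace_iff_odd_reductionPointCount _ (by norm_num : Nat.Prime 11) (by norm_num),
    reductionPointCount_11_43A1]
  decide

end Witness43A1

end Summit.BirchSwinnertonDyer.BirchSwinnertonDyer.Theorems.GenusExact.TwinSwap.KrizLiAnchor43a1

end
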